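import Summits.QuantumFields.YangMills.Theorems.FiniteRankMirrorRungMirrorFunctional
import Summits.QuantumFields.YangMills.Theorems.StaticSourceWitnessRungDipoleEnergyFloor

/-!
# BC5 rung (T3 witness) for `FiniteRankMirror.X₁ = FiniteRankMirrorFloor`, banked 2/3:
# the hyperscaling mirror floor of the lattice Maxwell field and X₁'s block with `J = 1`, `p = 0`

Tribunal-w seat `ym-mirror-bc5w-1` (g4, 2026-08-28), `--supports stmt-QuantumFields-25679` (route
`route-QuantumFields-FiniteRankMirror`); importable port of §7 of the crux work file
`Cruxes/FiniteRankMirrorFloor/Lines/rung_lattice.lean` (g3, commit 67076f913b1c).  The kernel cone floor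
(`kernel_cone_lower`: `curvatureTwoPoint (x;1,2) (y;1,2) ≥ 1/(4π²|x−y|⁴)` in the transverse cone, from the
tree's closed form and Lawler (1.37)), the bump probe `wfun ℓ` and the probe box `box X N` (here opened under
the name `pbox`, to keep `box 4 L` for the crux's volume cut-off of `Literature.Probability.LatticeModels`) are
REUSED BY NAME from the sibling banking `Theorems/StaticSourceWitnessRung{KernelCone,DipoleEnergyFloor}.lean`.

**Proved here (no `sorry`).**  `latticeMaxwell_mirrorFloor`: for every window `ℓ > 0` the bump `v = wfun ℓ`
(support in `{y₀ > 0} ∩ B̄(0,ℓ)`, `0 ≤ v ≤ 1`) and `a₀ = ℓ/(128 R₀)` give, for ALL spacings `0 < a ≤ a₀` and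
ALL cut-offs `L` with `ℓ ≤ aL`, `MF a v L ≥ κL = 1/(8π⁴·16912⁴)`.  Mechanism: `N = ⌊ℓ/(64a)⌋`,
`X = ⌊ℓ/(2a)⌋ ∈ [32N, 64N]`, `v ≡ 1` on the `(2N+1)⁴`-site box around `X e₀` (`probe_one`); a site `y` of that
box and the reflection `ϑy'` of another are separated by `z = ϑy − y'` with `|z₀| ∈ [62N,130N]`, `|z_k| ≤ 2N`
(`geom2`), inside the transverse cone of the parallel `(1,2)`-plaquette kernel, so
`curvatureTwoPoint ≥ 1/(4π²(16912N²)²)` (`kernel_lower_mirror`); keeping only these `(2N+1)⁸` nonnegative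
plaquette-pair terms of the Wick expansion `MF_eq`, `MF ≥ (2N+1)⁸·2/(16π⁴16912⁴N⁸) ≥ κL` — the powers of
the spacing cancel exactly, so `p = 0`.  Hence X₁'s `∃ J p κ …` block with `J = 1`, `p = 0`, both
spacing-indexed (`latticeMaxwell_finiteRankMirrorFloor`) and in the literal scheme-indexed shape of the crux
for ANY positive scheme `a β → 0` (`latticeMaxwell_finiteRankMirrorFloor_scheme`).

NOTHING HERE PROVES the Yang–Mills mass gap, `BalabanLadder.NT`, `FiniteRankMirrorFloor` itself (compact
SIMPLE `G`, Wilson's measure) or any item of the route: it is the free abelian model's instance of X₁'s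
block, a T3 witness of weakness only.
-/

open MeasureTheory ProbabilityTheory Filter
open scoped Real NNReal ENNReal Topology

noncomputable section

namespace Summit.QuantumFields.YangMills.Theorems.FiniteRankMirror.Rung

open Literature.Probability.LatticeModels Literature.MathematicalPhysics.QuantumLattice
  Literature.MathematicalPhysics.QuantumFieldTheory
open Summit.QuantumFields.YangMills.Theorems.StaticSourceWitness.Rung
  (Cfg μM Plane P12 plaqAt densA mem_plaqAt S S_eq bump wfun wfun_apply cy cy_apply_0 cy_apply_ne
    wfun_tsupport_pos wfun_tsupport_ball wfun_nonneg wfun_eq_one_of_coord probe_one kernel_cone_lower cube)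
open Summit.QuantumFields.YangMills.Theorems.StaticSourceWitness.Rung
  renaming box → pbox, card_box → card_pbox, box_bounds → pbox_bounds, box_subset_cube → pbox_subset_cube
open Metric Set

/-! ## §1 The bump probe is bounded by one; the probe box sits inside the crux's cut-off box -/

section Scale
variable {ℓ : ℝ} (hℓ : 0 < ℓ)
include hℓ

/-- `wfun ℓ ≤ 1`. [folklore] -/
theorem wfun_le_one (z : EuclideanSpace ℝ (Fin 4)) : wfun ℓ hℓ z ≤ 1 := by
  rw [wfun_apply]; exact (bump ℓ hℓ).le_one

/-- `|wfun ℓ| ≤ 1` (the crux's normalisation `∀ z, |v j z| ≤ 1`). [folklore] -/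
theorem wfun_abs_le_one (z : EuclideanSpace ℝ (Fin 4)) : |wfun ℓ hℓ z| ≤ 1 :=
  abs_le.2 ⟨by linarith [wfun_nonneg hℓ z], wfun_le_one hℓ z⟩

end Scale

/-- The sibling rung's volume cube `cube L` IS the crux's `box 4 L`. [folklore] -/
theorem cube_eq_box (L : ℕ) : cube L = box 4 L := rfl

/-- The probe box `X e₀ + [−N,N]⁴` lies in the crux's cut-off box `box 4 L` once `X + N ≤ L`. [folklore] -/
theorem pbox_subset_box {X N L : ℕ} (h : X + N ≤ L) : pbox X N ⊆ box 4 L := by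
  rw [← cube_eq_box]; exact pbox_subset_cube h

/-! ## §2 The mirror geometry and the uniform kernel floor -/

/-- The separation `z = ϑy − y'` between a probe-box site and the reflection of another
(`|y₀ − X|, |y₀' − X| ≤ N`, `|y_k|, |y_k'| ≤ N`, `32N ≤ X ≤ 64N`): transverse cone, far (`≥ N`), and not too
far (`|z|² ≤ 16912 N²`). [this route] -/
theorem geom2 {X N y0 y1 y2 y3 y0' y1' y2' y3' : ℝ} (hN : 1 ≤ N) (hX1 : 32 * N ≤ X) (hX2 : X ≤ 64 * N)
    (hy0 : |y0 - X| ≤ N) (hy1 : |y1| ≤ N) (hy2 : |y2| ≤ N) (hy3 : |y3| ≤ N)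
    (hy0' : |y0' - X| ≤ N) (hy1' : |y1'| ≤ N) (hy2' : |y2'| ≤ N) (hy3' : |y3'| ≤ N) :
    4 * ((y1 - y1') ^ 2 + (y2 - y2') ^ 2) ≤
        (-y0 - y0') ^ 2 + (y1 - y1') ^ 2 + (y2 - y2') ^ 2 + (y3 - y3') ^ 2 ∧
      N ^ 2 ≤ (-y0 - y0') ^ 2 + (y1 - y1') ^ 2 + (y2 - y2') ^ 2 + (y3 - y3') ^ 2 ∧
      (-y0 - y0') ^ 2 + (y1 - y1') ^ 2 + (y2 - y2') ^ 2 + (y3 - y3') ^ 2 ≤ 16912 * N ^ 2 := by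
  have sq_le_of_abs_le : ∀ {t B : ℝ}, |t| ≤ B → t ^ 2 ≤ B ^ 2 :=
    fun h => sq_le_sq' (abs_le.mp h).1 (abs_le.mp h).2
  have h1 : |y1 - y1'| ≤ 2 * N := by
    rw [abs_le] at hy1 hy1' ⊢; constructor <;> linarith
  have h2 : |y2 - y2'| ≤ 2 * N := by
    rw [abs_le] at hy2 hy2' ⊢; constructor <;> linarith
  have h3 : |y3 - y3'| ≤ 2 * N := by
    rw [abs_le] at hy3 hy3' ⊢; constructor <;> linarith
  have h0u : |(-y0 - y0')| ≤ 130 * N := by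
    rw [abs_le] at hy0 hy0' ⊢; constructor <;> linarith
  have h0l : 62 * N ≤ |(-y0 - y0')| := by
    rw [abs_le] at hy0 hy0'
    rw [le_abs]; right; linarith
  have s1 := sq_le_of_abs_le h1
  have s2 := sq_le_of_abs_le h2
  have s3 := sq_le_of_abs_le h3
  have s0u := sq_le_of_abs_le h0u
  have s0l : (62 * N) ^ 2 ≤ (-y0 - y0') ^ 2 := by
    have := sq_le_sq' (by linarith [abs_nonneg (-y0 - y0')]) h0l
    rwa [sq_abs] at this
  refine ⟨by nlinarith, by nlinarith, by nlinarith⟩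

/-- `|z|²` of the mirror separation `ϑy − y'` in coordinates. [folklore] -/
theorem S_tref_sub (y y' : Site 4) :
    S (tref y - y') = (-((y 0 : ℤ) : ℝ) - ((y' 0 : ℤ) : ℝ)) ^ 2 + (((y 1 : ℤ) : ℝ) - ((y' 1 : ℤ) : ℝ)) ^ 2 +
      (((y 2 : ℤ) : ℝ) - ((y' 2 : ℤ) : ℝ)) ^ 2 + (((y 3 : ℤ) : ℝ) - ((y' 3 : ℤ) : ℝ)) ^ 2 := by
  rw [S_eq]
  simp only [Pi.sub_apply, tref_apply_zero, tref_apply_of_ne y (show (1 : Fin 4) ≠ 0 by decide),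
    tref_apply_of_ne y (show (2 : Fin 4) ≠ 0 by decide), tref_apply_of_ne y (show (3 : Fin 4) ≠ 0 by decide)]
  push_cast
  ring

/-- **The uniform kernel floor between a probe-box site and the mirror image of another**:
`curvatureTwoPoint (ϑy;1,2) (y';1,2) ≥ 1/(4π²(16912N²)²)` for `y, y' ∈ X e₀ + [−N,N]⁴`, `32N ≤ X ≤ 64N`,
`N ≥ max(1, R₀)`. [this route] -/
theorem kernel_lower_mirror {R₀ : ℝ}
    (hker : ∀ x y : Site 4,
      4 * ((((x - y) 1 : ℤ) : ℝ) ^ 2 + (((x - y) 2 : ℤ) : ℝ) ^ 2) ≤ S (x - y) → R₀ ^ 2 ≤ S (x - y) →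
        1 / (4 * π ^ 2 * S (x - y) ^ 2) ≤ curvatureTwoPoint (x, P12) (y, P12))
    {X N : ℕ} {y y' : Site 4} (hR0 : 0 ≤ R₀) (hN : (1 : ℝ) ≤ N) (hR : R₀ ≤ N) (hX1 : 32 * (N : ℝ) ≤ X)
    (hX2 : (X : ℝ) ≤ 64 * N) (hy : y ∈ pbox X N) (hy' : y' ∈ pbox X N) :
    1 / (4 * π ^ 2 * (16912 * (N : ℝ) ^ 2) ^ 2) ≤ curvatureTwoPoint (tref y, P12) (y', P12) := by
  obtain ⟨b0, b1, b2, b3⟩ := pbox_bounds hy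
  obtain ⟨b0', b1', b2', b3'⟩ := pbox_bounds hy'
  obtain ⟨gcone, gfar, gnear⟩ := geom2 hN hX1 hX2 b0 b1 b2 b3 b0' b1' b2' b3'
  have hS := S_tref_sub y y'
  have hz1 : (((tref y - y') 1 : ℤ) : ℝ) = ((y 1 : ℤ) : ℝ) - ((y' 1 : ℤ) : ℝ) := by
    simp only [Pi.sub_apply, tref_apply_of_ne y (show (1 : Fin 4) ≠ 0 by decide)]; push_cast; ring
  have hz2 : (((tref y - y') 2 : ℤ) : ℝ) = ((y 2 : ℤ) : ℝ) - ((y' 2 : ℤ) : ℝ) := by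
    simp only [Pi.sub_apply, tref_apply_of_ne y (show (2 : Fin 4) ≠ 0 by decide)]; push_cast; ring
  have h := hker (tref y) y' (by rw [hz1, hz2, hS]; exact gcone)
    (by rw [hS]; exact le_trans (by nlinarith [sq_nonneg (N - R₀)]) gfar)
  refine le_trans ?_ h
  have hSpos : 0 < S (tref y - y') := by rw [hS]; nlinarith
  apply one_div_le_one_div_of_le (by positivity)
  have : S (tref y - y') ≤ 16912 * (N : ℝ) ^ 2 := by rw [hS]; exact gnear
  have h2 : S (tref y - y') ^ 2 ≤ (16912 * (N : ℝ) ^ 2) ^ 2 := pow_le_pow_left₀ hSpos.le this 2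
  nlinarith [Real.pi_pos, sq_nonneg π]

/-! ## §3 The hyperscaling mirror floor -/

/-- The floor constant of the lattice rung: `κL = 1/(8π⁴·16912⁴)` (spacing-free ⇒ `p = 0`). [this route] -/
def κL : ℝ := 1 / (8 * π ^ 4 * 16912 ^ 4)

/-- `0 < κL`. [this route] -/
theorem κL_pos : 0 < κL := by unfold κL; positivity

/-- **The hyperscaling mirror floor of the lattice Maxwell field**: for every window `ℓ` one bump probe `v`
(support in `{y₀ > 0} ∩ B̄(0, ℓ)`, `0 ≤ v ≤ 1`) and `a₀ > 0` such that for ALL spacings `0 < a ≤ a₀` and ALL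
cut-offs `L` with `ℓ ≤ aL`:  `κL ≤ MF a v L`. [this route] -/
theorem latticeMaxwell_mirrorFloor : ∀ ℓ : ℝ, 0 < ℓ →
    ∃ (v : SchwartzMap (EuclideanSpace ℝ (Fin 4)) ℝ) (a₀ : ℝ),
    tsupport (v : EuclideanSpace ℝ (Fin 4) → ℝ) ⊆ {y | 0 < y 0} ∧
    tsupport (v : EuclideanSpace ℝ (Fin 4) → ℝ) ⊆ Metric.closedBall 0 ℓ ∧
    (∀ z, |v z| ≤ 1) ∧ (∀ z, 0 ≤ v z) ∧ 0 < a₀ ∧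
    ∀ a : ℝ, 0 < a → a ≤ a₀ → ∀ L : ℕ, ℓ ≤ a * L → κL ≤ MF a (v : EuclideanSpace ℝ (Fin 4) → ℝ) L := by
  intro ℓ hℓ
  obtain ⟨R₀, hR₀1, hker⟩ := kernel_cone_lower
  have hR₀0 : 0 ≤ R₀ := by linarith
  refine ⟨wfun ℓ hℓ, ℓ / (128 * R₀), wfun_tsupport_pos hℓ, wfun_tsupport_ball hℓ, wfun_abs_le_one hℓ,
    wfun_nonneg hℓ, by positivity, ?_⟩
  intro a ha ha₀ L hL
  -- the two lattice scales `N = ⌊ℓ/(64a)⌋`, `X = ⌊ℓ/(2a)⌋`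
  set t : ℝ := ℓ / (64 * a) with ht
  have hat : a * t = ℓ / 64 := by rw [ht]; field_simp
  have ht2 : 2 * R₀ ≤ t := by
    rw [ht, le_div_iff₀ (by positivity)]
    have : a * (128 * R₀) ≤ ℓ := by rwa [le_div_iff₀ (by positivity)] at ha₀
    linarith
  set N : ℕ := ⌊t⌋₊ with hN
  have htN : (N : ℝ) ≤ t := Nat.floor_le (by positivity)
  have htN' : t < N + 1 := Nat.lt_floor_add_one t
  have hN1 : (1 : ℝ) ≤ N := by linarith
  have hRN : R₀ ≤ N := by linarith
  set X : ℕ := ⌊ℓ / (2 * a)⌋₊ with hX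
  have hX32t : ℓ / (2 * a) = 32 * t := by rw [ht]; field_simp; ring
  have hXle : (X : ℝ) ≤ 32 * t := by rw [← hX32t]; exact Nat.floor_le (by positivity)
  have hXgt : 32 * t < X + 1 := by rw [← hX32t]; exact Nat.lt_floor_add_one _
  have hX1nat : 32 * N ≤ X := by
    have h : ((32 * N : ℕ) : ℝ) < X + 1 := by push_cast; linarith
    have h' : 32 * N < X + 1 := by exact_mod_cast h
    omega
  have hX1 : 32 * (N : ℝ) ≤ X := by exact_mod_cast hX1nat
  have hX2 : (X : ℝ) ≤ 64 * N := by linarith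
  have haN : a * N ≤ ℓ / 64 := by rw [← hat]; exact mul_le_mul_of_nonneg_left htN ha.le
  have haX : a * X ≤ ℓ / 2 := by
    have : a * X ≤ a * (32 * t) := mul_le_mul_of_nonneg_left hXle ha.le
    linarith [show a * (32 * t) = ℓ / 2 by rw [show a * (32 * t) = 32 * (a * t) by ring, hat]; ring]
  have haX' : ℓ / 2 - a < a * X := by
    have : a * (32 * t) < a * (X + 1) := mul_lt_mul_of_pos_left hXgt ha
    have e : a * (32 * t) = ℓ / 2 := by rw [show a * (32 * t) = 32 * (a * t) by ring, hat]; ring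
    linarith
  have ha128 : a ≤ ℓ / 128 := by
    have : a * (128 * R₀) ≤ ℓ := by rwa [le_div_iff₀ (by positivity)] at ha₀
    rw [le_div_iff₀ (by norm_num)]
    nlinarith
  have habsX : |a * X - ℓ / 2| ≤ ℓ / 128 := by
    rw [abs_le]; constructor <;> linarith
  -- the probe box sits inside the cut-off box
  have hsub : pbox X N ⊆ box 4 L := by
    apply pbox_subset_box
    have h1 : ((X : ℝ) + N) ≤ L := by
      have hLa : ℓ / a ≤ L := by rw [div_le_iff₀ ha]; linarith
      have : (X : ℝ) + N ≤ 33 * t := by linarith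
      have e : ℓ / a = 64 * t := by rw [ht]; field_simp
      have : 33 * t ≤ 64 * t := by nlinarith
      linarith
    exact_mod_cast h1
  -- the floor: keep only the probe-box pairs and the parallel `(1,2)` plaquettes
  set kmin : ℝ := 1 / (4 * π ^ 2 * (16912 * (N : ℝ) ^ 2) ^ 2) with hkmin
  have hkmin0 : 0 ≤ kmin := by positivity
  have hv0 : ∀ z, 0 ≤ (wfun ℓ hℓ : EuclideanSpace ℝ (Fin 4) → ℝ) z := wfun_nonneg hℓ
  have hterm : ∀ y ∈ pbox X N, ∀ y' ∈ pbox X N, 2 * kmin ^ 2 ≤ mterm a (wfun ℓ hℓ) y y' := by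
    intro y hy y' hy'
    rw [mterm, probe_one hℓ ha.le hy habsX haN, probe_one hℓ ha.le hy' habsX haN, one_mul, one_mul]
    refine le_trans ?_ (Finset.single_le_sum
      (fun q _ => Finset.sum_nonneg fun q' _ => by positivity) (mem_plaqAt y))
    refine le_trans ?_ (Finset.single_le_sum (f := fun q' => 2 * curvatureTwoPoint (reflPlaq (y, P12)) q' ^ 2)
      (fun q' _ => by positivity) (mem_plaqAt y'))
    rw [reflPlaq_P12]
    have hk := kernel_lower_mirror hker hR₀0 hN1 hRN hX1 hX2 hy hy'
    have hk2 : kmin ^ 2 ≤ curvatureTwoPoint (tref y, P12) (y', P12) ^ 2 := pow_le_pow_left₀ hkmin0 hk 2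
    linarith
  have hinner : ∀ y ∈ pbox X N,
      ((pbox X N).card : ℝ) * (2 * kmin ^ 2) ≤ ∑ y' ∈ pbox X N, mterm a (wfun ℓ hℓ) y y' := by
    intro y hy
    have h := Finset.card_nsmul_le_sum (pbox X N) (fun y' => mterm a (wfun ℓ hℓ) y y') (2 * kmin ^ 2)
      (fun y' hy' => hterm y hy y' hy')
    rwa [nsmul_eq_mul] at h
  have houter : ((pbox X N).card : ℝ) * (((pbox X N).card : ℝ) * (2 * kmin ^ 2)) ≤
      ∑ y ∈ pbox X N, ∑ y' ∈ pbox X N, mterm a (wfun ℓ hℓ) y y' := by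
    have h := Finset.card_nsmul_le_sum (pbox X N) (fun y => ∑ y' ∈ pbox X N, mterm a (wfun ℓ hℓ) y y')
      (((pbox X N).card : ℝ) * (2 * kmin ^ 2)) hinner
    rwa [nsmul_eq_mul] at h
  have hN0 : (0 : ℝ) < N := by linarith
  rw [MF_eq]
  calc κL = (N : ℝ) ^ 8 * (2 * kmin ^ 2) := by
        rw [κL, hkmin]; field_simp; ring
    _ ≤ (((pbox X N).card : ℝ) * ((pbox X N).card : ℝ)) * (2 * kmin ^ 2) := by
        apply mul_le_mul_of_nonneg_right _ (by positivity)
        rw [card_pbox]; push_cast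
        have h1 : (N : ℝ) ≤ 2 * N + 1 := by linarith
        have h2 : (N : ℝ) ^ 8 ≤ (2 * N + 1) ^ 8 := pow_le_pow_left₀ hN0.le h1 8
        calc (N : ℝ) ^ 8 ≤ (2 * N + 1) ^ 8 := h2
          _ = (2 * (N : ℝ) + 1) ^ 4 * (2 * (N : ℝ) + 1) ^ 4 := by ring
    _ = ((pbox X N).card : ℝ) * (((pbox X N).card : ℝ) * (2 * kmin ^ 2)) := by ring
    _ ≤ ∑ y ∈ pbox X N, ∑ y' ∈ pbox X N, mterm a (wfun ℓ hℓ) y y' := houter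
    _ ≤ ∑ y ∈ pbox X N, ∑ y' ∈ box 4 L, mterm a (wfun ℓ hℓ) y y' :=
        Finset.sum_le_sum fun y _ =>
          Finset.sum_le_sum_of_subset_of_nonneg hsub fun y' _ _ => mterm_nonneg hv0 y y'
    _ ≤ ∑ y ∈ box 4 L, ∑ y' ∈ box 4 L, mterm a (wfun ℓ hℓ) y y' :=
        Finset.sum_le_sum_of_subset_of_nonneg hsub fun y _ _ =>
          Finset.sum_nonneg fun y' _ => mterm_nonneg hv0 y y'

/-! ## §4 X₁'s block in this model: `J = 1`, `p = 0` -/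

/-- **X₁'s block in the lattice Maxwell model, `J = 1`, `p = 0` (spacing-indexed form)**: verbatim the
`∃ J p κ, p < 8 ∧ 0 < κ ∧ ∀ ℓ₁ > 0, ∃ ℓ v …` block of `FiniteRankMirrorFloor` under the dictionary
`torusE ↦ ∫·dμM`, `dens ↦ densA`, `cfgReflect ↦ cfgReflA`, `a β ↦ a` (the block written out symbol for
symbol; `MF_def`). [this route] -/
theorem latticeMaxwell_finiteRankMirrorFloor :
    ∃ (J : ℕ) (p κ : ℝ), p < 8 ∧ 0 < κ ∧ ∀ ℓ₁ : ℝ, 0 < ℓ₁ →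
      ∃ (ℓ : ℝ) (v : Fin J → SchwartzMap (EuclideanSpace ℝ (Fin 4)) ℝ) (a₀ Λ₅ : ℝ), 0 < ℓ ∧ ℓ < ℓ₁ ∧
        (∀ j, tsupport (v j : EuclideanSpace ℝ (Fin 4) → ℝ) ⊆ {y | 0 < y 0} ∧
          tsupport (v j : EuclideanSpace ℝ (Fin 4) → ℝ) ⊆ Metric.closedBall 0 ℓ ∧ ∀ z, |v j z| ≤ 1) ∧
        0 < a₀ ∧ ∀ a : ℝ, 0 < a → a ≤ a₀ → ∀ L : ℕ, Λ₅ ≤ a * L →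
          κ * ℓ ^ p ≤ ∑ j,
            ((∫ ω, (∑ y ∈ box 4 L, v j (a • siteToE y) * densA y (cfgReflA ω)) *
                ∑ y ∈ box 4 L, v j (a • siteToE y) * densA y ω ∂μM) -
              (∫ ω, ∑ y ∈ box 4 L, v j (a • siteToE y) * densA y ω ∂μM) ^ 2) := by
  refine ⟨1, 0, κL, by norm_num, κL_pos, fun ℓ₁ hℓ₁ => ?_⟩
  obtain ⟨v, a₀, h1, h2, h3, _h4, ha₀, hfloor⟩ := latticeMaxwell_mirrorFloor (ℓ₁ / 2) (by positivity)
  refine ⟨ℓ₁ / 2, fun _ => v, a₀, ℓ₁ / 2, by positivity, by linarith, fun _ => ⟨h1, h2, h3⟩, ha₀,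
    fun a ha haa L hL => ?_⟩
  rw [Real.rpow_zero, mul_one, Fin.sum_univ_one, ← MF_def]
  exact hfloor a ha haa L hL

/-- **X₁'s block in the lattice Maxwell model, literal scheme-indexed shape**: for EVERY positive scheme
`a β → 0` (the crux's `(∀ β, 0 < a β) ∧ Tendsto a atTop (nhds 0)`), the block
`∃ J p κ, p < 8 ∧ 0 < κ ∧ ∀ ℓ₁ > 0, ∃ ℓ v β₅ Λ₅, … ∀ β ≥ β₅, ∀ L, Λ₅ ≤ a β · L → κ ℓ^p ≤ ∑_j (mirror block)`
holds with `J = 1`, `p = 0`. [this route] -/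
theorem latticeMaxwell_finiteRankMirrorFloor_scheme (a : ℝ → ℝ) (ha : ∀ β, 0 < a β)
    (ha0 : Tendsto a atTop (nhds 0)) :
    ∃ (J : ℕ) (p κ : ℝ), p < 8 ∧ 0 < κ ∧ ∀ ℓ₁ : ℝ, 0 < ℓ₁ →
      ∃ (ℓ : ℝ) (v : Fin J → SchwartzMap (EuclideanSpace ℝ (Fin 4)) ℝ) (β₅ Λ₅ : ℝ), 0 < ℓ ∧ ℓ < ℓ₁ ∧
        (∀ j, tsupport (v j : EuclideanSpace ℝ (Fin 4) → ℝ) ⊆ {y | 0 < y 0} ∧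
          tsupport (v j : EuclideanSpace ℝ (Fin 4) → ℝ) ⊆ Metric.closedBall 0 ℓ ∧ ∀ z, |v j z| ≤ 1) ∧
        ∀ β : ℝ, β₅ ≤ β → ∀ L : ℕ, Λ₅ ≤ a β * L →
          κ * ℓ ^ p ≤ ∑ j,
            ((∫ ω, (∑ y ∈ box 4 L, v j (a β • siteToE y) * densA y (cfgReflA ω)) *
                ∑ y ∈ box 4 L, v j (a β • siteToE y) * densA y ω ∂μM) -
              (∫ ω, ∑ y ∈ box 4 L, v j (a β • siteToE y) * densA y ω ∂μM) ^ 2) := by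
  refine ⟨1, 0, κL, by norm_num, κL_pos, fun ℓ₁ hℓ₁ => ?_⟩
  obtain ⟨v, a₀, h1, h2, h3, _h4, ha₀, hfloor⟩ := latticeMaxwell_mirrorFloor (ℓ₁ / 2) (by positivity)
  obtain ⟨β₅, hβ₅⟩ := Filter.eventually_atTop.1 (ha0.eventually (eventually_lt_nhds ha₀))
  refine ⟨ℓ₁ / 2, fun _ => v, β₅, ℓ₁ / 2, by positivity, by linarith, fun _ => ⟨h1, h2, h3⟩,
    fun β hβ L hL => ?_⟩
  rw [Real.rpow_zero, mul_one, Fin.sum_univ_one, ← MF_def]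
  exact hfloor (a β) (ha β) (hβ₅ β hβ).le L hL

end Summit.QuantumFields.YangMills.Theorems.FiniteRankMirror.Rung

end
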